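import Summits.ValiantsHypothesis.ValiantsHypothesis.Theorems.BarrierLeverChowThinRowsSubcubePairs

/-!
# Route BarrierLever — item `ChowHitsThinRowPartitionMinors` (stmt-ValiantsHypothesis-20195):
# rows of a BALANCED indicator design on a star (prelims for the pair layer on star columns)

Helper file (`--supports stmt-ValiantsHypothesis-20195`; cell valiant-natproofs, rung V4, 𝒟-side of
door (c); prover seat val-np-p8 gen 2).  Closes NO item; imports prover g10's `…ChowThinRowsSubcubePairs`
(second-order derivative formula `coeff_pair_prod`, first-order `coeff_single_prod`); no route file,
no definitions.  Companion: `…ChowThinRowsStarColumns` (the theorem).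

Content: for the indicator forms `φ_V = 1 + Σ_a κ_a(V) x_a + Σ_{c ∈ V} y_c` over a Finset `𝒦` of sets
of size `≤ 1` and a BALANCED `x`-design (`Σ_{V ∈ 𝒦} κ_a(V) = 0` for the relevant `a`), the partition
coefficients at the columns `∅` / `{c}` are: row `{a}` ↦ `0` / `-κ_a({c})`; row `{a,b}` ↦
`-Σ_V κ_a(V)κ_b(V)` / `-Σ_V κ_a(V)κ_b(V) + 2 κ_a({c}) κ_b({c})` (the HADAMARD term).  Used as follows.

**Theorem `chowHits_thinRows_starColumns`.**  For every height `h ≥ 1`, every `r`, all injective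
THIN rows `u i` (`|u i| ≤ 2`) one of which is `∅`, and all injective columns of size `≤ 1`
(`w j ∈ {∅} ∪ {{c}}` — the STAR, i.e. the `0`-dimensional down-closed complex), ONE explicit product
of `h + h` affine forms with coefficients in `ℤ` makes the partition minor nonsingular.  This is the
family on which every labelling theorem of the cell is silent (`{∅, a, b, ab} × {∅, {1}, {2}, {3}}` =
the «killer» of HOME/val-np-p8/MEMO-pairlayer-g0 §3 (X), which needs two generic variables, and the
Leibniz quadruples of planner g15's MEMO-normalforms §7.2): no union labelling `L(a) ∪ L(b) ∈ 𝒟`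
exists there because the star has no faces of size `2`.

**The witness (BALANCED HADAMARD design).**  Forms indexed by `𝒦 = {∅} ∪ {w j : w j ≠ ∅}`:
`φ_V = 1 + Σ_a κ_a(V) x_a + Σ_{c ∈ V} y_c` with `κ_a(w j) = [a ∈ u (π j)]` for the nonempty columns
(`π` = the transposition pairing the empty column, if any, with the empty row) and the BALANCING
`κ_a(∅) = -#{j : w j ≠ ∅, a ∈ u (π j)}`, so that `Σ_{V ∈ 𝒦} κ_a(V) = 0` for every `a`.  Then
(`coeff_single_*_bal`, `coeff_pair_*_bal`): row `∅` is the all-ones vector, row `{a}` is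
`-(indicator of the columns j with a ∈ u (π j))`, and row `{a,b}` is `-Q_{ab} · 𝟙 + 2 · e_{π⁻¹ i}`
(the HADAMARD term `2 κ_a κ_b`), whence `M v = 0 ⇒ v = 0` by peeling `∅`-row, pair rows, singleton
rows (`mulVec_injective_iff_isUnit`).

WHAT THIS IS NOT: rows without the empty row, and columns of size `≥ 2`, are not treated here; items
20195 / 20172 / 19717 are NOT proved; nothing on crux stmt-ValiantsHypothesis-14610 or `VP ≠ VNP`.
-/

set_option linter.dupNamespace false

namespace Summit.ValiantsHypothesis.ValiantsHypothesis.Theorems.BarrierLever.ChowSubcube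

open Finset MvPolynomial
open Summit.ValiantsHypothesis.ValiantsHypothesis.Theorems.BarrierLever.ChowFactor
  (coeff_partitionExpo_mul_affine totalDegree_affine_le)
open Summit.ValiantsHypothesis.ValiantsHypothesis.Theorems.BarrierLever.ProductStateSums
  (castAdd_ne_natAdd partitionExpo_apply_castAdd partitionExpo_apply_natAdd)
open Summit.ValiantsHypothesis.ValiantsHypothesis.Theorems.BarrierLever.CorankRepair (partitionExpo_eq_iff)

variable {h : ℕ}

/-! ## 1. Coefficients of indicator-form products at a singleton column -/

/-- The `x`-free coefficient at a singleton column `{c}` of `∏_{V ∈ 𝒦} φ_V` counts the forms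
containing `y_c`. -/
theorem coeff_empty_singleton_prod (κ : Fin h → Finset (Fin h) → ℂ) (𝒦 : Finset (Finset (Fin h)))
    (c : Fin h) :
    coeff (∑ a ∈ (∅ : Finset (Fin h)), Finsupp.single (Fin.castAdd h a) 1 +
        ∑ c' ∈ ({c} : Finset (Fin h)), Finsupp.single (Fin.natAdd h c') 1)
        (∏ V ∈ 𝒦, (C 1 + ∑ a, C (κ a V) * X (Fin.castAdd h a) +
          ∑ c', C (if c' ∈ V then (1 : ℂ) else 0) * X (Fin.natAdd h c'))) =
      ((𝒦.filter fun V => c ∈ V).card : ℂ) := by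
  classical
  induction 𝒦 using Finset.induction_on with
  | empty =>
    rw [Finset.prod_empty, coeff_one, if_neg, Finset.filter_empty, Finset.card_empty, Nat.cast_zero]
    intro h0
    have := DFunLike.congr_fun h0 (Fin.natAdd h c)
    rw [partitionExpo_apply_natAdd] at this
    simp at this
  | insert V 𝒦 hV ih =>
    rw [Finset.prod_insert hV, mul_comm, coeff_empty_mul_form, ih, Finset.sum_filter,
      Finset.sum_singleton, Finset.filter_insert]
    by_cases hc : c ∈ V
    · rw [if_pos hc, if_pos hc, Finset.erase_singleton, coeff_empty_empty_prod,
        Finset.card_insert_of_notMem (fun hm => hV (Finset.mem_of_mem_filter V hm))]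
      push_cast
      ring
    · rw [if_neg hc, if_neg hc, add_zero]

/-- In a family of sets of size `≤ 1`, the sets containing `c` are `{c}` (if present). -/
theorem card_filter_mem_of_card_le_one (𝒦 : Finset (Finset (Fin h))) (h1 : ∀ V ∈ 𝒦, V.card ≤ 1)
    (c : Fin h) :
    ((𝒦.filter fun V => c ∈ V).card : ℂ) = if ({c} : Finset (Fin h)) ∈ 𝒦 then 1 else 0 := by
  classical
  have hfil : (𝒦.filter fun V => c ∈ V) = 𝒦.filter fun V => V = {c} := by
    refine Finset.filter_congr fun V hV => ⟨fun hcV => ?_, fun e => by rw [e]; exact mem_singleton_self _⟩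
    exact Finset.eq_singleton_iff_unique_mem.mpr
      ⟨hcV, fun x hx => Finset.card_le_one.mp (h1 V hV) x hx c hcV⟩
  rw [hfil, Finset.filter_eq']
  split_ifs <;> simp

/-! ## 2. The rows of a BALANCED design (`Σ_V κ_a(V) = 0`) on a family of sets of size `≤ 1` -/

/-- Balanced design, singleton row, empty column: the entry vanishes. -/
theorem coeff_single_empty_prod_bal (κ : Fin h → Finset (Fin h) → ℂ) (𝒦 : Finset (Finset (Fin h)))
    (a : Fin h) (hA : ∑ V ∈ 𝒦, κ a V = 0) :
    coeff (∑ a' ∈ ({a} : Finset (Fin h)), Finsupp.single (Fin.castAdd h a') 1 +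
        ∑ c ∈ (∅ : Finset (Fin h)), Finsupp.single (Fin.natAdd h c) 1)
        (∏ V ∈ 𝒦, (C 1 + ∑ a, C (κ a V) * X (Fin.castAdd h a) +
          ∑ c, C (if c ∈ V then (1 : ℂ) else 0) * X (Fin.natAdd h c))) = 0 := by
  classical
  rw [coeff_single_prod, Finset.sum_congr rfl fun V _ => by rw [coeff_empty_empty_prod, mul_one]]
  exact hA

/-- Balanced design on sets of size `≤ 1`, singleton row `{a}`, singleton column `{c} ∈ 𝒦`:
the entry is `-κ_a({c})`. -/
theorem coeff_single_singleton_prod_bal (κ : Fin h → Finset (Fin h) → ℂ) (𝒦 : Finset (Finset (Fin h)))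
    (h1 : ∀ V ∈ 𝒦, V.card ≤ 1) (a c : Fin h) (hc : ({c} : Finset (Fin h)) ∈ 𝒦)
    (hA : ∑ V ∈ 𝒦, κ a V = 0) :
    coeff (∑ a' ∈ ({a} : Finset (Fin h)), Finsupp.single (Fin.castAdd h a') 1 +
        ∑ c' ∈ ({c} : Finset (Fin h)), Finsupp.single (Fin.natAdd h c') 1)
        (∏ V ∈ 𝒦, (C 1 + ∑ a, C (κ a V) * X (Fin.castAdd h a) +
          ∑ c', C (if c' ∈ V then (1 : ℂ) else 0) * X (Fin.natAdd h c'))) = -κ a {c} := by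
  classical
  rw [coeff_single_prod]
  have hterm : ∀ V ∈ 𝒦, κ a V *
      coeff (∑ a' ∈ (∅ : Finset (Fin h)), Finsupp.single (Fin.castAdd h a') 1 +
          ∑ c' ∈ ({c} : Finset (Fin h)), Finsupp.single (Fin.natAdd h c') 1)
        (∏ V' ∈ 𝒦.erase V, (C 1 + ∑ a, C (κ a V') * X (Fin.castAdd h a) +
          ∑ c', C (if c' ∈ V' then (1 : ℂ) else 0) * X (Fin.natAdd h c'))) =
      κ a V - (if V = {c} then κ a V else 0) := by
    intro V hV
    rw [coeff_empty_singleton_prod, card_filter_mem_of_card_le_one (𝒦.erase V)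
      (fun V' hV' => h1 V' (Finset.mem_of_mem_erase hV'))]
    by_cases hVc : V = {c}
    · rw [if_neg (fun hh => (Finset.mem_erase.mp hh).1 hVc.symm), if_pos hVc, mul_zero, sub_self]
    · rw [if_pos (Finset.mem_erase.mpr ⟨fun e => hVc e.symm, hc⟩), if_neg hVc, mul_one, sub_zero]
  rw [Finset.sum_congr rfl hterm, Finset.sum_sub_distrib, hA, Finset.sum_ite_eq' 𝒦 {c}, if_pos hc,
    zero_sub]

/-- Balanced design, pair row `{a,b}` (`a ≠ b`), empty column: the entry is `-Σ_V κ_a(V) κ_b(V)`. -/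
theorem coeff_pair_empty_prod_bal (κ : Fin h → Finset (Fin h) → ℂ) (𝒦 : Finset (Finset (Fin h)))
    {a b : Fin h} (hab : a ≠ b) (hB : ∑ V ∈ 𝒦, κ b V = 0) :
    coeff (∑ a' ∈ ({a, b} : Finset (Fin h)), Finsupp.single (Fin.castAdd h a') 1 +
        ∑ c ∈ (∅ : Finset (Fin h)), Finsupp.single (Fin.natAdd h c) 1)
        (∏ V ∈ 𝒦, (C 1 + ∑ a, C (κ a V) * X (Fin.castAdd h a) +
          ∑ c, C (if c ∈ V then (1 : ℂ) else 0) * X (Fin.natAdd h c))) =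
      -∑ V ∈ 𝒦, κ a V * κ b V := by
  classical
  rw [coeff_pair_prod κ 𝒦 hab, ← Finset.sum_neg_distrib]
  refine Finset.sum_congr rfl fun V hV => ?_
  rw [coeff_single_prod]
  have hin : ∑ V' ∈ 𝒦.erase V, κ b V' *
      coeff (∑ a' ∈ (∅ : Finset (Fin h)), Finsupp.single (Fin.castAdd h a') 1 +
          ∑ c ∈ (∅ : Finset (Fin h)), Finsupp.single (Fin.natAdd h c) 1)
        (∏ V'' ∈ (𝒦.erase V).erase V', (C 1 + ∑ a, C (κ a V'') * X (Fin.castAdd h a) +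
          ∑ c, C (if c ∈ V'' then (1 : ℂ) else 0) * X (Fin.natAdd h c))) = -κ b V := by
    rw [Finset.sum_congr rfl fun V' _ => by rw [coeff_empty_empty_prod, mul_one],
      Finset.sum_erase_eq_sub hV, hB, zero_sub]
  rw [hin]
  ring

/-- Balanced design on sets of size `≤ 1`, pair row `{a,b}` (`a ≠ b`), singleton column `{c} ∈ 𝒦`:
the entry is `-Σ_V κ_a(V) κ_b(V) + 2 κ_a({c}) κ_b({c})` — the HADAMARD term. -/
theorem coeff_pair_singleton_prod_bal (κ : Fin h → Finset (Fin h) → ℂ) (𝒦 : Finset (Finset (Fin h)))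
    (h1 : ∀ V ∈ 𝒦, V.card ≤ 1) {a b : Fin h} (hab : a ≠ b) (c : Fin h)
    (hc : ({c} : Finset (Fin h)) ∈ 𝒦) (hA : ∑ V ∈ 𝒦, κ a V = 0) (hB : ∑ V ∈ 𝒦, κ b V = 0) :
    coeff (∑ a' ∈ ({a, b} : Finset (Fin h)), Finsupp.single (Fin.castAdd h a') 1 +
        ∑ c' ∈ ({c} : Finset (Fin h)), Finsupp.single (Fin.natAdd h c') 1)
        (∏ V ∈ 𝒦, (C 1 + ∑ a, C (κ a V) * X (Fin.castAdd h a) +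
          ∑ c', C (if c' ∈ V then (1 : ℂ) else 0) * X (Fin.natAdd h c'))) =
      -∑ V ∈ 𝒦, κ a V * κ b V + 2 * (κ a {c} * κ b {c}) := by
  classical
  rw [coeff_pair_prod κ 𝒦 hab]
  -- the inner first-order coefficient of the leave-`V`-out product
  have hin : ∀ V ∈ 𝒦,
      coeff (∑ a' ∈ ({b} : Finset (Fin h)), Finsupp.single (Fin.castAdd h a') 1 +
          ∑ c' ∈ ({c} : Finset (Fin h)), Finsupp.single (Fin.natAdd h c') 1)
        (∏ V' ∈ 𝒦.erase V, (C 1 + ∑ a, C (κ a V') * X (Fin.castAdd h a) +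
          ∑ c', C (if c' ∈ V' then (1 : ℂ) else 0) * X (Fin.natAdd h c'))) =
      if V = {c} then 0 else -(κ b V + κ b {c}) := by
    intro V hV
    rw [coeff_single_prod]
    have hterm : ∀ V' ∈ 𝒦.erase V, κ b V' *
        coeff (∑ a' ∈ (∅ : Finset (Fin h)), Finsupp.single (Fin.castAdd h a') 1 +
            ∑ c' ∈ ({c} : Finset (Fin h)), Finsupp.single (Fin.natAdd h c') 1)
          (∏ V'' ∈ (𝒦.erase V).erase V', (C 1 + ∑ a, C (κ a V'') * X (Fin.castAdd h a) +
            ∑ c', C (if c' ∈ V'' then (1 : ℂ) else 0) * X (Fin.natAdd h c'))) =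
        if V = {c} then 0 else (κ b V' - if V' = {c} then κ b V' else 0) := by
      intro V' hV'
      rw [coeff_empty_singleton_prod, card_filter_mem_of_card_le_one ((𝒦.erase V).erase V')
        (fun V'' hV'' => h1 V'' (Finset.mem_of_mem_erase (Finset.mem_of_mem_erase hV'')))]
      by_cases hVc : V = {c}
      · rw [if_pos hVc, if_neg (fun hh =>
          (Finset.mem_erase.mp (Finset.mem_erase.mp hh).2).1 hVc.symm), mul_zero]
      · rw [if_neg hVc]
        by_cases hV'c : V' = {c}
        · rw [if_neg (fun hh => (Finset.mem_erase.mp hh).1 hV'c.symm), if_pos hV'c, mul_zero, sub_self]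
        · rw [if_pos (Finset.mem_erase.mpr ⟨fun e => hV'c e.symm,
            Finset.mem_erase.mpr ⟨fun e => hVc e.symm, hc⟩⟩), if_neg hV'c, mul_one, sub_zero]
    rw [Finset.sum_congr rfl hterm]
    by_cases hVc : V = {c}
    · simp only [if_pos hVc, Finset.sum_const_zero]
    · have hcK : ({c} : Finset (Fin h)) ∈ 𝒦.erase V := Finset.mem_erase.mpr ⟨fun e => hVc e.symm, hc⟩
      simp only [if_neg hVc]
      rw [Finset.sum_sub_distrib, Finset.sum_erase_eq_sub hV, hB, Finset.sum_ite_eq' (𝒦.erase V) {c},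
        if_pos hcK]
      ring
  rw [Finset.sum_congr rfl fun V hV => by rw [hin V hV]]
  -- Σ_V κ_a(V) · (if V = {c} then 0 else -(κ_b V + κ_b {c}))
  have hsplit : ∀ V ∈ 𝒦, κ a V * (if V = {c} then 0 else -(κ b V + κ b {c})) =
      (-(κ a V * κ b V) - κ b {c} * κ a V) -
        (if V = {c} then (-(κ a V * κ b V) - κ b {c} * κ a V) else 0) := by
    intro V _
    split_ifs <;> ring
  rw [Finset.sum_congr rfl hsplit, Finset.sum_sub_distrib, Finset.sum_sub_distrib, Finset.sum_ite_eq' 𝒦 {c},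
    if_pos hc, ← Finset.mul_sum, hA, Finset.sum_neg_distrib]
  ring

end Summit.ValiantsHypothesis.ValiantsHypothesis.Theorems.BarrierLever.ChowSubcube
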